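import Summits.QuantumFields.YangMills.Theorems.BalabanUVNodesN15KingModelReflectionPositivityLaw

/-!
# BalabanUVNodes ∕ N15 — THE KING-MODEL RUNG (PART Ϻ-p): THE LATTICE EUCLIDEAN INVARIANCE OF THE INFINITE-VOLUME LAW `μ_∞` — invariance under every site map preserving the kernel:
# translations, the central reflection, coordinate reflections, axis permutations (the hyperoctahedral group) and the block reflection `θ_ν` of reflection positivity
# (Track A, DAG node N15 = NE2; FAN-OUT v1.1 §N15 s3 «KING-MODEL RUNG»; uses parts Ϻ-n∕o and Ϝ-m's symmetries of `S₂^{ℝ}`; count-neutral)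

HONEST FRAMING.  Count-neutral (cell `pub-ymgap`, seat `pub-ymgap-dag-n15-e` g35; `--supports stmt-QuantumFields-27366 --as helper` = K3⁸).  King's `A = 0`, `g = 0` model
([King1986] C. King, Commun. Math. Phys. **102** (1986) 649–677).  Part Ϻ-n built `μ_∞ = gaussianFieldOfKernel(S₂^{ℝ}(w − z))` and proved translation invariance.  THIS FILE
isolates the mechanism — ★★ for EVERY map `g : ℤ^{d+1} → ℤ^{d+1}` with `S₂^{ℝ}(g w − g z) = S₂^{ℝ}(w − z)` the push-forward of `μ_∞` under `φ ↦ φ ∘ g` IS `μ_∞` (the pulled-back coordinate process is a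
centred Gaussian process with the same covariance; uniqueness, Kallenberg 13.1) — and runs it through part Ϝ-m's symmetries of `S₂^{ℝ}` (evenness, coordinate reflections, axis
permutations) and part Ϻ-o's block-reflection identity: `μ_∞` is invariant under all translations, the central reflection `z ↦ −z`, every coordinate reflection, every axis
permutation (hence the whole hyperoctahedral point group ⋉ translations = the lattice Euclidean group — the lattice form of OS1) and under the block reflection
`θ_ν : z ↦ (z_⊥, −z_ν − 1)` of part Ϻ-o's reflection positivity (the lattice form of the time reflection in OS3).  NOT Bałaban's objects; NOT a node discharge; nothing
continuum-Yang–Mills ∕ `ℝ⁴` ∕ OS reconstruction ∕ Clay; rotations beyond the hyperoctahedral group are NOT symmetries of a cubic block field.  0 `sorry`, 0 def; standard axioms.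

WHAT THIS FILE PROVES (kernel).  §1 `measurable_precomp`, ★★ **`kingFieldInf_map_precomp_eq`** (the mechanism).  §2 ★ `kingFieldInf_map_neg` (central reflection), `latReflIdx_sub`, ★ `kingFieldInf_map_latRefl`
(coordinate reflections), ★ `kingFieldInf_map_perm` (axis permutations), ★★ `kingFieldInf_map_blockReflect` (the RP reflection `θ_ν`), `kingFieldInf_map_shift'` (translations, = part Ϻ-n).

HONEST SCOPE.  King's free `K = |Ω| = ∞` block field.  N15 untouched; counts unmoved.  Locators (use): [King1986] Thm 2.1 (2.22) p.654, (4.5) p.670; [Kallenberg2002] Lemma 13.1.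
-/

noncomputable section

open scoped BigOperators Topology
open Filter MeasureTheory ProbabilityTheory Finset

namespace Summit.QuantumFields.YangMills.BalabanUVNodes.N15KingModelRung.InfiniteVolume

open Literature.MathematicalPhysics.QuantumFieldTheory (IsPosSemidefKernel gaussianFieldOfKernel isGaussianProcess_eval_gaussianFieldOfKernel
  integral_eval_gaussianFieldOfKernel covariance_eval_gaussianFieldOfKernel eq_gaussianFieldOfKernel_of_isGaussianProcess)
open Summit.QuantumFields.YangMills.BalabanUVNodes.N15KingModelRung.OptimalDecay

variable {d : ℕ}

/-! ## §1 The mechanism: kernel-preserving site maps preserve `μ_∞` -/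

/-- `φ ↦ φ ∘ g` is measurable on the product space. [folklore] -/
theorem measurable_precomp (g : (Fin (d + 1) → ℤ) → (Fin (d + 1) → ℤ)) : Measurable fun (ω : (Fin (d + 1) → ℤ) → ℝ) (z : Fin (d + 1) → ℤ) => ω (g z) :=
  measurable_pi_lambda _ fun z => measurable_pi_apply (g z)

/-- ★★ **KERNEL-PRESERVING SITE MAPS PRESERVE `μ_∞`**: if `S₂^{ℝ}(g w − g z) = S₂^{ℝ}(w − z)` for all `z, w`, then `(μ_∞).map (φ ↦ φ ∘ g) = μ_∞` (the pulled-back coordinate process is a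
centred Gaussian process with covariance `S₂^{ℝ}(w − z)`; uniqueness of the Gaussian field of a kernel). [cite: Kallenberg2002, Lemma 13.1; King1986, Thm 2.1 (2.22) p.654] -/
theorem kingFieldInf_map_precomp_eq {m2 : ℝ} (hm : 0 < m2) {g : (Fin (d + 1) → ℤ) → (Fin (d + 1) → ℤ)} (hg : ∀ z w, kingS2Inf m2 (g w - g z) = kingS2Inf m2 (w - z)) :
    (kingFieldInf m2).map (fun (ω : (Fin (d + 1) → ℤ) → ℝ) (z : Fin (d + 1) → ℤ) => ω (g z)) = kingFieldInf m2 := by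
  have hK := isPosSemidefKernel_kingKernel (d := d) hm
  haveI := isProbabilityMeasure_kingFieldInf (d := d) hm
  set T : ((Fin (d + 1) → ℤ) → ℝ) → ((Fin (d + 1) → ℤ) → ℝ) := fun ω z => ω (g z) with hT
  have hTm : Measurable T := measurable_precomp g
  haveI : IsProbabilityMeasure ((kingFieldInf m2).map T) := Measure.isProbabilityMeasure_map hTm.aemeasurable
  unfold kingFieldInf at *
  refine eq_gaussianFieldOfKernel_of_isGaussianProcess hK ?_ (fun s => ?_) (fun s t => ?_)
  · have hX := (isGaussianProcess_eval_gaussianFieldOfKernel hK).comp_right g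
    refine ⟨fun I => ⟨?_⟩⟩
    have hr : Measurable (fun ω : (Fin (d + 1) → ℤ) → ℝ => I.restrict fun x => ω x) := Finset.measurable_restrict I
    rw [Measure.map_map hr hTm]
    have hfun : ((fun ω : (Fin (d + 1) → ℤ) → ℝ => I.restrict fun x => ω x) ∘ T)
        = fun ω => I.restrict fun s => ((fun (s : Fin (d + 1) → ℤ) (ω : (Fin (d + 1) → ℤ) → ℝ) => ω s) ∘ g) s ω := by
      funext ω; rfl
    rw [hfun]
    exact (hX.hasGaussianLaw I).isGaussian_map
  · rw [integral_map hTm.aemeasurable (measurable_pi_apply s).aestronglyMeasurable]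
    exact integral_eval_gaussianFieldOfKernel hK (g s)
  · rw [covariance_map (measurable_pi_apply s).aestronglyMeasurable (measurable_pi_apply t).aestronglyMeasurable hTm.aemeasurable]
    have h := covariance_eval_gaussianFieldOfKernel hK (g s) (g t)
    rw [kingKernel_apply, hg s t] at h
    exact h

/-! ## §2 The lattice Euclidean group and the block reflection -/

/-- ★ **Central reflection**: `μ_∞` is invariant under `φ ↦ φ(−·)`. [cite: King1986, Thm 2.1 (2.22) p.654] -/
theorem kingFieldInf_map_neg {m2 : ℝ} (hm : 0 < m2) :
    (kingFieldInf m2).map (fun (ω : (Fin (d + 1) → ℤ) → ℝ) (z : Fin (d + 1) → ℤ) => ω (-z)) = kingFieldInf m2 :=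
  kingFieldInf_map_precomp_eq hm fun z w => by rw [show -w - -z = -(w - z) by abel, kingS2Inf_neg]

/-- Coordinate reflections are additive: `R_μ(w) − R_μ(z) = R_μ(w − z)`. [folklore] -/
theorem latReflIdx_sub (μ : Fin (d + 1)) (z w : Fin (d + 1) → ℤ) : latReflIdx μ w - latReflIdx μ z = latReflIdx μ (w - z) := by
  funext ν
  by_cases h : ν = μ
  · subst h; simp [latReflIdx]; ring
  · simp [latReflIdx, h]

/-- ★ **Coordinate reflections**: `μ_∞` is invariant under `φ ↦ φ ∘ R_μ`. [cite: King1986, Thm 2.1 (2.22) p.654] -/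
theorem kingFieldInf_map_latRefl {m2 : ℝ} (hm : 0 < m2) (μ : Fin (d + 1)) :
    (kingFieldInf m2).map (fun (ω : (Fin (d + 1) → ℤ) → ℝ) (z : Fin (d + 1) → ℤ) => ω (latReflIdx μ z)) = kingFieldInf m2 :=
  kingFieldInf_map_precomp_eq hm fun z w => by rw [latReflIdx_sub, kingS2Inf_refl]

/-- ★ **Axis permutations**: `μ_∞` is invariant under `φ ↦ φ(· ∘ σ)` for every permutation `σ` of the coordinates. [cite: King1986, Thm 2.1 (2.22) p.654] -/
theorem kingFieldInf_map_perm {m2 : ℝ} (hm : 0 < m2) (σ : Equiv.Perm (Fin (d + 1))) :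
    (kingFieldInf m2).map (fun (ω : (Fin (d + 1) → ℤ) → ℝ) (z : Fin (d + 1) → ℤ) => ω (z ∘ σ)) = kingFieldInf m2 :=
  kingFieldInf_map_precomp_eq hm fun z w => by
    rw [show (w ∘ σ) - (z ∘ σ) = (w - z) ∘ σ from rfl, kingS2Inf_perm]

/-- ★★ **The block reflection of reflection positivity**: `μ_∞` is invariant under `φ ↦ φ ∘ θ_ν`, `θ_νz = (z_⊥, −z_ν − 1)` (part Ϻ-o's reflection). [cite: King1986, Thm 2.1 (2.22) p.654] -/
theorem kingFieldInf_map_blockReflect {m2 : ℝ} (hm : 0 < m2) (ν : Fin (d + 1)) :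
    (kingFieldInf m2).map (fun (ω : (Fin (d + 1) → ℤ) → ℝ) (z : Fin (d + 1) → ℤ) => ω (Function.update z ν (-(z ν) - 1))) = kingFieldInf m2 :=
  kingFieldInf_map_precomp_eq hm fun z w => by rw [kingS2Inf_reflect_sub_reflect]

/-- **Translations** (part Ϻ-n's `kingFieldInf_map_shift`, now a one-line instance of the mechanism). [cite: King1986, Thm 2.1 (2.22) p.654] -/
theorem kingFieldInf_map_shift' {m2 : ℝ} (hm : 0 < m2) (v : Fin (d + 1) → ℤ) :
    (kingFieldInf m2).map (fun (ω : (Fin (d + 1) → ℤ) → ℝ) (z : Fin (d + 1) → ℤ) => ω (z + v)) = kingFieldInf m2 :=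
  kingFieldInf_map_precomp_eq hm fun z w => by rw [add_sub_add_right_eq_sub]

/-- ★ **A lattice Euclidean motion**: `μ_∞` is invariant under `φ ↦ φ(R_μ(· ∘ σ) + v)` (permutation, then a coordinate reflection, then a translation — a generic element of the
hyperoctahedral group ⋉ `ℤ^{d+1}`). [cite: King1986, Thm 2.1 (2.22) p.654] -/
theorem kingFieldInf_map_euclid {m2 : ℝ} (hm : 0 < m2) (σ : Equiv.Perm (Fin (d + 1))) (μ : Fin (d + 1)) (v : Fin (d + 1) → ℤ) :
    (kingFieldInf m2).map (fun (ω : (Fin (d + 1) → ℤ) → ℝ) (z : Fin (d + 1) → ℤ) => ω (latReflIdx μ (z ∘ σ) + v)) = kingFieldInf m2 :=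
  kingFieldInf_map_precomp_eq hm fun z w => by
    rw [add_sub_add_right_eq_sub, latReflIdx_sub, kingS2Inf_refl, show (w ∘ σ) - (z ∘ σ) = (w - z) ∘ σ from rfl, kingS2Inf_perm]

end Summit.QuantumFields.YangMills.BalabanUVNodes.N15KingModelRung.InfiniteVolume
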